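import Literature.Probability.Percolation.PlateCrossingEvents
import Literature.Probability.Percolation.BoxCrossingUpperBound
import Literature.Probability.Percolation.ZdNearCriticalWindow
import Literature.Probability.Percolation.HalfSpacePinnedPairs
import Literature.Probability.Percolation.SharpnessDCTProofs
import Literature.Probability.Percolation.PlateChartRoom
import HarnessLib

/-!
# Polarisation of plate-crossing probabilities for critical bond percolation on `ℤ²`

Topic `Literature/Probability/Percolation`; proofs only.  For the plate events of
`PlateCrossingEvents.lean` read through a plane homeomorphism `Φ`, **planar duality with room**
(hypothesis `hG1`, the statement proved for the `oracle-sandwich` line as stub G1) implies the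
polarisation lower bound

`P(MV_Z(P')) + 1 - P(MH_Z(P'♭)) ≤ 2 · P(V_Z(P₂))` eventually as `δ → 0⁺`

(`polarZ_of`), where `P = bondPercolation ℤ² ½`, `V_Z(P₂)` is the primal vertical plate crossing of
the plate `(1+κ, 1-κ, 1+κ)`, `MV_Z(P')`/`MH_Z(P'♭)` are the monochromatic (primal-or-dual) vertical /
horizontal plate crossings of the plates `(1+4κ/5, 1-4κ/5, 1+4κ/5)` / `(1+3κ/5, 1+4κ/5, 1-3κ/5)`.
Ingredients: self-duality of `bondPercolation ℤ² ½` under `dualConfig` composed with the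
half-diagonal shift (`ZdNearCriticalWindow`, `HalfSpacePinnedPairs`), monotonicity of plate
events, chart room.  This is the `ℤ²` half of the mono-polarisation engine of the transfer
"loop-ensemble closeness ⇒ crossing probabilities close" (Camia–Newman, CMP 268 (2006), §5–6).

## References

* F. Camia, C. M. Newman, Comm. Math. Phys. 268 (2006), §5–6 [CamiaNewman2006].
* G. Grimmett, *Percolation*, 2nd ed., Springer 1999, §11 [Grimmett1999].
-/

noncomputable section

namespace Literature.Probability.Percolation

open Literature.Probability.RandomPlanarGeometry
open Literature.Probability.LatticeModels
open Filter _root_.Topology Set _root_.MeasureTheory Metric Complex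

/-- Plate/zone events on `ℤ²` are measurable (countable vertex type). [folklore] -/
theorem measurableSet_openCrossing_site' (S A B : Set (Site 2)) :
    MeasurableSet (openCrossing S A B : Set (BondConfig (Site 2))) := by
  have h : openCrossing S A B = ⋃ x ∈ A, ⋃ y ∈ B, (openConnIn S x y : Set (BondConfig (Site 2))) := by
    ext ω
    simp only [mem_openCrossing_iff, Set.mem_iUnion, exists_prop]
  rw [h]
  exact MeasurableSet.biUnion (Set.to_countable A) fun x _ =>
    MeasurableSet.biUnion (Set.to_countable B) fun y _ => measurableSet_openConnIn_of_countable S x y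

/-- Transfer of "drawn by `dualDraw` inside `Φ(S)`" to "drawn by `meshPoint` inside `Φ(S')`" when `S'`
contains the `ν`-box-neighbourhood of `S ⊆ plateBox 2 2` and `δ ≤ ρ`. [folklore] -/
theorem drawP_mem_image_of_drawD_mem {Φ : ℂ ≃ₜ ℂ} {ν ρ δ : ℝ} (hδ : 0 ≤ δ) (hδρ : δ ≤ ρ)
    (hroom : ∀ z ∈ plateBox 2 2, ∀ p : ℂ, dist p (Φ z) ≤ ρ → dist (Φ.symm p) z ≤ ν)
    {S S' : Set ℂ} (hS : S ⊆ plateBox 2 2) (hSS' : ∀ z ∈ S, ∀ z' : ℂ, dist z' z ≤ ν → z' ∈ S')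
    {w : Site 2} (hw : dualDraw δ w ∈ Φ '' S) : meshPoint δ w ∈ Φ '' S' := by
  obtain ⟨z, hz, hzw⟩ := hw
  refine ⟨Φ.symm (meshPoint δ w), hSS' z hz _ (hroom z (hS hz) _ ?_), Φ.apply_symm_apply _⟩
  rw [hzw, dist_comm]
  exact (dist_dualDraw_meshPoint_le hδ w).trans hδρ

/-- S1 from G1 (ℤ² plate duality) + exact bond self-duality + inclusions. [folklore] -/
theorem polarZ_of
    (hG1 : ∀ (Φ : ℂ ≃ₜ ℂ) (ν : ℝ), 0 < ν → ∃ δ₀ : ℝ, 0 < δ₀ ∧ ∀ δ : ℝ, 0 < δ → δ ≤ δ₀ →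
      ∀ ω : BondConfig (Site 2), ω ⊆ (zdGraph 2).edgeSet →
        (∀ x yin yout : ℝ, 2 * ν < x → x ≤ 2 → 0 < yin → yin + 2 * ν ≤ yout → yout ≤ 2 →
          (ω ∉ zdPlateV (meshPoint δ) Φ x yin yout → dualConfig ω ∈ zdPlateH (dualDraw δ) Φ (x - 2 * ν) x (yin + 2 * ν)) ∧
          (dualConfig ω ∉ zdPlateV (dualDraw δ) Φ x yin yout → ω ∈ zdPlateH (meshPoint δ) Φ (x - 2 * ν) x (yin + 2 * ν))) ∧
        (∀ xin xout y : ℝ, 2 * ν < y → y ≤ 2 → 0 < xin → xin + 2 * ν ≤ xout → xout ≤ 2 →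
          (ω ∉ zdPlateH (meshPoint δ) Φ xin xout y → dualConfig ω ∈ zdPlateV (dualDraw δ) Φ (xin + 2 * ν) (y - 2 * ν) y) ∧
          (dualConfig ω ∉ zdPlateH (dualDraw δ) Φ xin xout y → ω ∈ zdPlateV (meshPoint δ) Φ (xin + 2 * ν) (y - 2 * ν) y))) :
  ∀ (Φ : ℂ ≃ₜ ℂ) (κ : ℝ), 0 < κ → κ ≤ 1 / 2 → ∀ᶠ δ : ℝ in 𝓝[>] 0,
    (bondPercolation (zdGraph 2) half).real (zdMonoPlateV Φ δ (1 + 4 * κ / 5) (1 - 4 * κ / 5) (1 + 4 * κ / 5)) + 1 -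
        (bondPercolation (zdGraph 2) half).real (zdMonoPlateH Φ δ (1 + 3 * κ / 5) (1 + 4 * κ / 5) (1 - 3 * κ / 5)) ≤
      2 * (bondPercolation (zdGraph 2) half).real (zdPlateV (meshPoint δ) Φ (1 + κ) (1 - κ) (1 + κ)) := by
  intro Φ κ hκ hκ1
  -- room for the duality and for the dual shift
  have hν : 0 < κ / 10 := by positivity
  obtain ⟨δ₁, hδ₁, hdual⟩ := hG1 Φ (κ / 10) hν
  obtain ⟨ρ, hρ, hρ1, hroom⟩ := exists_chart_room_symm' Φ hν
  have hev : ∀ᶠ δ : ℝ in 𝓝[>] 0, δ ∈ Ioo 0 (min δ₁ ρ) := Ioo_mem_nhdsGT (lt_min hδ₁ hρ)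
  filter_upwards [hev] with δ hδ
  have hδpos : 0 < δ := hδ.1
  have hδ₁' : δ ≤ δ₁ := (hδ.2.trans_le (min_le_left _ _)).le
  have hδρ : δ ≤ ρ := (hδ.2.trans_le (min_le_right _ _)).le
  -- the four events
  set A : Set (BondConfig (Site 2)) := zdPlateV (meshPoint δ) Φ (1 + 4 * κ / 5) (1 - 4 * κ / 5) (1 + 4 * κ / 5) with hA
  set E : Set (BondConfig (Site 2)) := zdPlateV (dualDraw δ) Φ (1 + 4 * κ / 5) (1 - 4 * κ / 5) (1 + 4 * κ / 5) with hE
  set B : Set (BondConfig (Site 2)) := dualConfig ⁻¹' E with hB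
  set V₂ : Set (BondConfig (Site 2)) := zdPlateV (meshPoint δ) Φ (1 + κ) (1 - κ) (1 + κ) with hV₂
  set Hm : Set (BondConfig (Site 2)) := zdMonoPlateH Φ δ (1 + 3 * κ / 5) (1 + 4 * κ / 5) (1 - 3 * κ / 5) with hHm
  have hAm : MeasurableSet A := measurableSet_openCrossing_site' _ _ _
  have hEm : MeasurableSet E := measurableSet_openCrossing_site' _ _ _
  have hBm : MeasurableSet B := measurable_dualConfig hEm
  have hHmm : MeasurableSet Hm :=
    (measurableSet_openCrossing_site' _ _ _).union (measurable_dualConfig (measurableSet_openCrossing_site' _ _ _))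
  -- (1) A ⊆ V₂
  have h1 : A ⊆ V₂ := zdPlateV_mono (meshPoint δ) Φ (by linarith) (by linarith) (by linarith)
  -- (2) E ⊆ V₂ (dual drawing inside the smaller plate ⇒ primal drawing inside the bigger one)
  have hboxsub : plateBox (1 + 4 * κ / 5) (1 + 4 * κ / 5) ⊆ plateBox 2 2 := fun z hz =>
    ⟨⟨by linarith [hz.1.1], by linarith [hz.1.2]⟩, ⟨by linarith [hz.2.1], by linarith [hz.2.2]⟩⟩
  have hgrow : ∀ z ∈ plateBox (1 + 4 * κ / 5) (1 + 4 * κ / 5), ∀ z' : ℂ, dist z' z ≤ κ / 10 →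
      z' ∈ plateBox (1 + κ) (1 + κ) := by
    intro z hz z' hd
    have hre : |z'.re - z.re| ≤ κ / 10 := (abs_re_le_norm (z' - z)).trans (by rwa [← dist_eq_norm])
    have him : |z'.im - z.im| ≤ κ / 10 := (abs_im_le_norm (z' - z)).trans (by rwa [← dist_eq_norm])
    rw [abs_le] at hre him
    exact ⟨⟨by linarith [hz.1.1], by linarith [hz.1.2]⟩, ⟨by linarith [hz.2.1], by linarith [hz.2.2]⟩⟩
  have h2 : E ⊆ V₂ := by
    rintro ω ⟨u, hu, v, hv, hconn⟩
    have huS : dualDraw δ u ∈ Φ '' plateBox (1 + 4 * κ / 5) (1 + 4 * κ / 5) := hconn.1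
    have hvS : dualDraw δ v ∈ Φ '' plateBox (1 + 4 * κ / 5) (1 + 4 * κ / 5) := hconn.2.1
    -- zones together with the plate
    have huZ : meshPoint δ u ∈ Φ '' {z : ℂ | z.im ≤ -(1 - κ)} := by
      obtain ⟨z, hz, hzu⟩ := huS
      obtain ⟨z₂, hz₂, hz₂u⟩ := hu
      have : z₂ = z := Φ.injective (hz₂u.trans hzu.symm)
      subst this
      refine ⟨Φ.symm (meshPoint δ u), ?_, Φ.apply_symm_apply _⟩
      have hd : dist (Φ.symm (meshPoint δ u)) z₂ ≤ κ / 10 := hroom z₂ (hboxsub hz) _ (by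
        rw [hz₂u, dist_comm]; exact (dist_dualDraw_meshPoint_le hδpos.le u).trans hδρ)
      have him : |(Φ.symm (meshPoint δ u)).im - z₂.im| ≤ κ / 10 :=
        (abs_im_le_norm (Φ.symm (meshPoint δ u) - z₂)).trans (by rwa [← dist_eq_norm])
      rw [abs_le] at him
      have hz₂' : z₂.im ≤ -(1 - 4 * κ / 5) := hz₂
      show (Φ.symm (meshPoint δ u)).im ≤ -(1 - κ)
      linarith
    have hvZ : meshPoint δ v ∈ Φ '' {z : ℂ | 1 - κ ≤ z.im} := by
      obtain ⟨z, hz, hzv⟩ := hvS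
      obtain ⟨z₂, hz₂, hz₂v⟩ := hv
      have : z₂ = z := Φ.injective (hz₂v.trans hzv.symm)
      subst this
      refine ⟨Φ.symm (meshPoint δ v), ?_, Φ.apply_symm_apply _⟩
      have hd : dist (Φ.symm (meshPoint δ v)) z₂ ≤ κ / 10 := hroom z₂ (hboxsub hz) _ (by
        rw [hz₂v, dist_comm]; exact (dist_dualDraw_meshPoint_le hδpos.le v).trans hδρ)
      have him : |(Φ.symm (meshPoint δ v)).im - z₂.im| ≤ κ / 10 :=
        (abs_im_le_norm (Φ.symm (meshPoint δ v) - z₂)).trans (by rwa [← dist_eq_norm])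
      rw [abs_le] at him
      have hz₂' : 1 - 4 * κ / 5 ≤ z₂.im := hz₂
      show 1 - κ ≤ (Φ.symm (meshPoint δ v)).im
      linarith
    refine ⟨u, huZ, v, hvZ, openConnIn_mono (fun w hw => ?_) u v hconn⟩
    exact drawP_mem_image_of_drawD_mem hδpos.le hδρ hroom hboxsub hgrow hw
  -- (3) P(B) = P(E)
  have h3 : (bondPercolation (zdGraph 2) half).real B = (bondPercolation (zdGraph 2) half).real E := bondPercolation_half_real_preimage_dualConfig hEm
  -- (5) off Hm, both A and B hold (a.e., on lattice configurations)
  have h5 : ∀ ω : BondConfig (Site 2), ω ⊆ (zdGraph 2).edgeSet → ω ∉ Hm → ω ∈ A ∩ B := by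
    intro ω hω hnot
    have hH := (hdual δ hδpos hδ₁' ω hω).2 (1 + 3 * κ / 5) (1 + 4 * κ / 5) (1 - 3 * κ / 5)
      (by linarith) (by linarith) (by linarith) (by linarith) (by linarith)
    simp only [hHm, zdMonoPlateH, mem_union, mem_preimage, not_or] at hnot
    have e1 : (1 + 3 * κ / 5) + 2 * (κ / 10) = 1 + 4 * κ / 5 := by ring
    have e2 : (1 - 3 * κ / 5) - 2 * (κ / 10) = 1 - 4 * κ / 5 := by ring
    constructor
    · have hd := hH.2 hnot.2
      rw [e1, e2] at hd
      exact zdPlateV_mono (meshPoint δ) Φ le_rfl le_rfl (by linarith) hd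
    · have hd := hH.1 hnot.1
      rw [e1, e2] at hd
      exact zdPlateV_mono (dualDraw δ) Φ le_rfl le_rfl (by linarith) hd
  have h5' : (bondPercolation (zdGraph 2) half).real Hmᶜ ≤ (bondPercolation (zdGraph 2) half).real (A ∩ B) := by
    simp only [measureReal_def]
    refine ENNReal.toReal_mono (measure_ne_top _ _) (measure_mono_ae ?_)
    filter_upwards [ae_subset_edgeSet (zdGraph 2) half] with ω hω
    intro hc
    exact h5 ω hω hc
  -- assemble
  have hunion : (bondPercolation (zdGraph 2) half).real (A ∪ B) + (bondPercolation (zdGraph 2) half).real (A ∩ B) = (bondPercolation (zdGraph 2) half).real A + (bondPercolation (zdGraph 2) half).real B :=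
    measureReal_union_add_inter hBm
  have hcompl : (bondPercolation (zdGraph 2) half).real Hmᶜ = 1 - (bondPercolation (zdGraph 2) half).real Hm := by
    rw [measureReal_compl hHmm, probReal_univ]
  have hA2 : (bondPercolation (zdGraph 2) half).real A ≤ (bondPercolation (zdGraph 2) half).real V₂ := measureReal_mono h1
  have hB2 : (bondPercolation (zdGraph 2) half).real B ≤ (bondPercolation (zdGraph 2) half).real V₂ := h3 ▸ measureReal_mono h2
  have hMV : (bondPercolation (zdGraph 2) half).real (zdMonoPlateV Φ δ (1 + 4 * κ / 5) (1 - 4 * κ / 5) (1 + 4 * κ / 5)) = (bondPercolation (zdGraph 2) half).real (A ∪ B) := rfl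
  rw [hMV]
  linarith

end Literature.Probability.Percolation

end
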